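import Mathlib.Combinatorics.SimpleGraph.Walk.Basic
import Mathlib.Data.Finset.Card
import HarnessLib

/-!
# Rank of far pieces: descendant sets shrink strictly (witness unit U4b)

Crux `SAWLeftRightFKG.FKGToTraversalBound` (stmt-CriticalPhenomena-1878), line `slit-necklace`,
stub `card_desc_lt_of_mem_desc` (lead prover-line-stmt-CriticalPhenomena-1878-c5-0).

Pure graph combinatorics over an arbitrary simple graph.  Pieces (named by natural numbers) have pairwise
disjoint, nonempty vertex sets `Vs P`, every vertex of every piece being joined to a `root` by a walk inside
`U`.  `desc P` is the set of pieces `R ≠ P` *separated from the root by `P`*: every `U`-walk from `Vs R`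
to the root meets `Vs P`.  We show `R ∈ desc P → (desc R).card < (desc P).card`, i.e. `P ↦ (desc P).card`
is a strictly monotone rank along "separated from the root by":

* transitivity `desc R ⊆ desc P` (a `U`-walk from `Vs R'` meets `Vs R`, and its suffix from that vertex is a
  `U`-walk from `Vs R`, hence meets `Vs P`);
* antisymmetry (two disjoint sets cannot each separate the other from the root when one of them has a
  `U`-walk to the root: induction on the walk);
* `R ∈ desc P \ desc R`.

All statements folklore; Mathlib only.
-/

noncomputable section

namespace Summit.CriticalPhenomena.SAWScalingLimit.Theorems.FKGToTraversalBound.SlitNecklace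

section RankDesc

variable {V : Type*} {G : SimpleGraph V}

/-- Every vertex `z` on a walk `w` to `y` starts a walk to `y` whose support is contained in that of `w`
(the suffix of `w` from `z`; stated without `DecidableEq`). [folklore] -/
private theorem exists_suffix_support_subset {x y : V} (w : G.Walk x y) (z : V)
    (hz : z ∈ w.support) : ∃ w' : G.Walk z y, ∀ v ∈ w'.support, v ∈ w.support := by
  induction w with
  | nil =>
    rw [SimpleGraph.Walk.support_nil, List.mem_singleton] at hz
    subst hz
    exact ⟨SimpleGraph.Walk.nil, fun v hv => hv⟩
  | cons h p ih =>
    rw [SimpleGraph.Walk.support_cons, List.mem_cons] at hz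
    rcases hz with rfl | hz
    · exact ⟨SimpleGraph.Walk.cons h p, fun v hv => hv⟩
    · obtain ⟨w', hw'⟩ := ih hz
      exact ⟨w', fun v hv => by
        rw [SimpleGraph.Walk.support_cons, List.mem_cons]
        exact Or.inr (hw' v hv)⟩

/-- Antisymmetry of "separated from the root by": if `A` and `B` are disjoint, every `U`-walk from `A` to `y`
meets `B` and every `U`-walk from `B` to `y` meets `A`, then no `U`-walk to `y` visits `A` or `B`
(induction on the walk). [folklore] -/
private theorem not_mem_of_mutual_sep (U A B : Set V) (hAB : Disjoint A B) {x y : V} (w : G.Walk x y)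
    (hA : ∀ x' ∈ A, ∀ w' : G.Walk x' y, (∀ z ∈ w'.support, z ∈ U) → ∃ z ∈ w'.support, z ∈ B)
    (hB : ∀ x' ∈ B, ∀ w' : G.Walk x' y, (∀ z ∈ w'.support, z ∈ U) → ∃ z ∈ w'.support, z ∈ A)
    (hU : ∀ z ∈ w.support, z ∈ U) : ∀ z ∈ w.support, z ∉ A ∧ z ∉ B := by
  induction w with
  | nil =>
    rename_i u
    intro z hz
    rw [SimpleGraph.Walk.support_nil, List.mem_singleton] at hz
    subst hz
    refine ⟨fun hzA => ?_, fun hzB => ?_⟩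
    · obtain ⟨b, hb, hbB⟩ := hA z hzA SimpleGraph.Walk.nil hU
      rw [SimpleGraph.Walk.support_nil, List.mem_singleton] at hb
      subst hb
      exact Set.disjoint_left.1 hAB hzA hbB
    · obtain ⟨a, ha, haA⟩ := hB z hzB SimpleGraph.Walk.nil hU
      rw [SimpleGraph.Walk.support_nil, List.mem_singleton] at ha
      subst ha
      exact Set.disjoint_left.1 hAB haA hzB
  | cons h p ih =>
    rename_i u v w'
    have hUp : ∀ z ∈ p.support, z ∈ U := fun z hz => hU z (by
      rw [SimpleGraph.Walk.support_cons, List.mem_cons]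
      exact Or.inr hz)
    have ihp := ih hA hB hUp
    intro z hz
    rw [SimpleGraph.Walk.support_cons, List.mem_cons] at hz
    rcases hz with rfl | hz
    · refine ⟨fun hzA => ?_, fun hzB => ?_⟩
      · obtain ⟨b, hb, hbB⟩ := hA z hzA (SimpleGraph.Walk.cons h p) hU
        rw [SimpleGraph.Walk.support_cons, List.mem_cons] at hb
        rcases hb with rfl | hb
        · exact Set.disjoint_left.1 hAB hzA hbB
        · exact (ihp b hb).2 hbB
      · obtain ⟨a, ha, haA⟩ := hB z hzB (SimpleGraph.Walk.cons h p) hU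
        rw [SimpleGraph.Walk.support_cons, List.mem_cons] at ha
        rcases ha with rfl | ha
        · exact Set.disjoint_left.1 hAB haA hzB
        · exact (ihp a ha).1 haA
    · exact ihp z hz

/-- **Witness unit U4b (rank of far pieces).**  Pieces with pairwise disjoint nonempty vertex sets, each
joined to the root inside `U`; `desc P` = the pieces `R ≠ P` all of whose `U`-walks to the root meet
`Vs P`.  Then `R ∈ desc P → (desc R).card < (desc P).card`. [folklore] -/
theorem card_desc_lt_of_mem_desc : ∀ {V : Type*} {G : SimpleGraph V} (U : Set V) (root : V) (pieces : Finset ℕ) (Vs : ℕ → Set V) (desc : ℕ → Finset ℕ), (∀ P ∈ pieces, ∀ R ∈ pieces, P ≠ R → Disjoint (Vs P) (Vs R)) → (∀ P ∈ pieces, (Vs P).Nonempty) → (∀ P ∈ pieces, ∀ x ∈ Vs P, ∃ w : G.Walk x root, ∀ z ∈ w.support, z ∈ U) → (∀ P R, R ∈ desc P ↔ (R ∈ pieces ∧ R ≠ P ∧ ∀ x ∈ Vs R, ∀ w : G.Walk x root, (∀ z ∈ w.support, z ∈ U) → ∃ z ∈ w.support, z ∈ Vs P)) → ∀ P ∈ pieces,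 ∀ R ∈ desc P, (desc R).card < (desc P).card := by
  intro V G U root pieces Vs desc hdisj hne hconn hdesc P hP R hR
  obtain ⟨hRp, hRP, hRsep⟩ := (hdesc P R).1 hR
  -- antisymmetry: `P ∉ desc R`
  have hPR : P ∉ desc R := by
    intro hP'
    obtain ⟨-, -, hPsep⟩ := (hdesc R P).1 hP'
    obtain ⟨x, hx⟩ := hne P hP
    obtain ⟨w, hw⟩ := hconn P hP x hx
    exact (not_mem_of_mutual_sep U (Vs P) (Vs R) (hdisj P hP R hRp hRP.symm) w hPsep hRsep hw x
      w.start_mem_support).1 hx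
  -- transitivity: `desc R ⊆ desc P`
  have hsub : desc R ⊆ desc P := by
    intro R' hR'
    obtain ⟨hR'p, -, hR'sep⟩ := (hdesc R R').1 hR'
    refine (hdesc P R').2 ⟨hR'p, fun h => hPR (h ▸ hR'), fun x hx w hw => ?_⟩
    obtain ⟨z, hz, hzR⟩ := hR'sep x hx w hw
    obtain ⟨w', hw'⟩ := exists_suffix_support_subset w z hz
    obtain ⟨z', hz', hz'P⟩ := hRsep z hzR w' (fun v hv => hw v (hw' v hv))
    exact ⟨z', hw' z' hz', hz'P⟩
  have hRR : R ∉ desc R := fun h => ((hdesc R R).1 h).2.1 rfl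
  exact Finset.card_lt_card ((Finset.ssubset_iff_of_subset hsub).2 ⟨R, hR, hRR⟩)

end RankDesc

end Summit.CriticalPhenomena.SAWScalingLimit.Theorems.FKGToTraversalBound.SlitNecklace

end
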